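import Summits.CriticalPhenomena.PercolationContinuityZ3.Theorems.PercNearOneGluingNoHeavyLowerTailKnQuestion8CoefficientwiseCellPA
import Summits.CriticalPhenomena.PercolationContinuityZ3.Theorems.PercNearOneGluingNoHeavyLowerTailKnQuestion8CoefficientwiseCellPABridge
import HarnessLib

/-!
# CELL-PA for multigraphs: inside a red cell the blue cluster of `x` is conditionally positively associated given `z ∉ C_x`

Support file (`--supports stmt-CriticalPhenomena-4575`, closed), prover `prim-lf-2` (gen 32).  No definitions, no named facts, no sorries;
standard axioms.  This is `…CoefficientwiseCellPA` (simple graphs) with the injectivity hypothesis on `ends` removed, using the multigraph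
bridge `Coefficientwise.sum_subcube_eq_weight` of `…CoefficientwiseCellPABridge`: under the uniform colouring of the free edges `E₁`
(with `B₀` surely blue) the set of blue PAIRS `ends '' (B₀ ∪ t)` has the product law with parameters `1` on `ends '' B₀` and
`1 − 2^{−#{i ∈ E₁ : ends i = e}}` elsewhere, to which van den Berg–Häggström–Kahn's Theorem 1.3 (`BHK2006.core`) applies.
* `Coefficientwise.cell_conditionalPA_multi` — `(Σ_D f(L))(Σ_D g(L)) ≤ |D|·Σ_D f(L)g(L)`, `L(t) = C_x(B₀ ∪ t)`, `D = {t ⊆ E₁ : z ∉ L t}`;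
* `Coefficientwise.cell_cov_form_multi` — the covariance form with constants `a, b`.
Memo `prim-lf-2/CW-POINTS-gen32.md` §5; design `prim-lf-2/CW-VDBHK-gen29.md` §8.7.
[cite: VandenbergHaggstromKahn2005, Thm. 1.3 (p. 6) with Thm. 1.1 (pp. 3–5)]
-/

noncomputable section

open Finset
open Literature.Probability.Percolation
open Literature.Probability.Percolation.BHK2006
open DecisionTree (ind ind_of_mem ind_of_not_mem ind_nonneg)

namespace Summit.CriticalPhenomena.PercolationContinuityZ3.Theorems

namespace Coefficientwise

open scoped Classical

variable {ι V : Type*} [DecidableEq ι] [Fintype V] [DecidableEq V]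

/-- **CELL-PA for multigraphs (van den Berg–Häggström–Kahn's Theorem 1.3 inside a cell of the two-colouring cube).**  Multigraph
`ends : ι → Sym2 V` (parallel edges allowed), vertices `x, z`, disjoint edge sets `B₀` (surely blue) and `E₁` (free), `L(t) = C_x(B₀ ∪ t)` the (blue) cluster of `x`,
`D = {t ⊆ E₁ : z ∉ L(t)}`.  For monotone `f, g : Set V → ℝ`,
  `(Σ_{t∈D} f(L t))·(Σ_{t∈D} g(L t)) ≤ |D| · Σ_{t∈D} f(L t)·g(L t)`:
conditioned on `z ∉ C_x`, the cluster of `x` under the uniform colouring of the free edges is positively associated.  This is the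
engine `V_𝒦 ≥ 0` of prim-lf-2's MEANS-K split (memo CW-VDBHK-gen29 §8.3), i.e. BHK's theorem at `p_e ∈ {0, ½, 1}`, obtained from
the tree's proved finite-sum form `BHK2006.core` (`U = univ`, `X = Y = {z}`) through the multigraph bridge `sum_subcube_eq_weight`
(a pair of vertices is open iff one of its parallel copies is blue: product weights `1 − 2^{−mult}`).
[cite: VandenbergHaggstromKahn2005, Thm. 1.3 (p. 6) with Thm. 1.1 (pp. 3–5)] -/
theorem cell_conditionalPA_multi (ends : ι → Sym2 V) (x z : V) (B₀ E₁ : Finset ι)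
    (hdis : Disjoint B₀ E₁) (f g : Set V → ℝ) (hf : Monotone f) (hg : Monotone g) :
    (∑ t ∈ E₁.powerset.filter (fun t => z ∉ openCluster (ends '' (↑(B₀ ∪ t) : Set ι)) x),
        f (openCluster (ends '' (↑(B₀ ∪ t) : Set ι)) x)) *
      (∑ t ∈ E₁.powerset.filter (fun t => z ∉ openCluster (ends '' (↑(B₀ ∪ t) : Set ι)) x),
        g (openCluster (ends '' (↑(B₀ ∪ t) : Set ι)) x)) ≤
    ((E₁.powerset.filter (fun t => z ∉ openCluster (ends '' (↑(B₀ ∪ t) : Set ι)) x)).card : ℝ) *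
      ∑ t ∈ E₁.powerset.filter (fun t => z ∉ openCluster (ends '' (↑(B₀ ∪ t) : Set ι)) x),
        f (openCluster (ends '' (↑(B₀ ∪ t) : Set ι)) x) * g (openCluster (ends '' (↑(B₀ ∪ t) : Set ι)) x) := by
  -- notation
  set L : Finset ι → Set V := fun t => openCluster (ends '' (↑(B₀ ∪ t) : Set ι)) x with hL
  set D : Finset (Finset ι) := E₁.powerset.filter (fun t => z ∉ L t) with hD
  change (∑ t ∈ D, f (L t)) * (∑ t ∈ D, g (L t)) ≤ (D.card : ℝ) * ∑ t ∈ D, f (L t) * g (L t)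
  -- the trivial case `x = z` (then `D = ∅`)
  by_cases hxz : x = z
  · subst hxz
    have hDe : D = ∅ := by
      refine Finset.filter_false_of_mem fun t _ => ?_
      simp only [hL, not_not]
      exact mem_openCluster_self _ x
    simp [hDe]
  -- the product weight of the sub-cube and its basic properties
  set w : Sym2 V → ℝ := fun e => if e ∈ B₀.image ends then (1 : ℝ)
      else 1 - (1 / 2 : ℝ) ^ (E₁.filter (fun i => ends i = e)).card with hw
  have hw0 : ∀ e, 0 ≤ w e := fun e => by
    simp only [hw]; split_ifs
    · norm_num
    · have : (1 / 2 : ℝ) ^ (E₁.filter (fun i => ends i = e)).card ≤ 1 := pow_le_one₀ (by norm_num) (by norm_num)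
      linarith
  have hw1 : ∀ e, w e ≤ 1 := fun e => by
    simp only [hw]; split_ifs
    · norm_num
    · have : 0 ≤ (1 / 2 : ℝ) ^ (E₁.filter (fun i => ends i = e)).card := by positivity
      linarith
  set Ω : Finset ι → Set (Sym2 V) := fun t => (↑((B₀ ∪ t).image ends) : Set (Sym2 V)) with hΩ
  have hΩL : ∀ t, openCluster (Ω t) x = L t := fun t => by
    simp only [hΩ, hL, Finset.coe_image]
  set c : ℝ := (1 / 2 : ℝ) ^ E₁.card with hc
  have hcpos : 0 < c := by positivity
  have bridge : ∀ φ : Set (Sym2 V) → ℝ, ∑ ω : Set (Sym2 V), weight w ω * φ ω = c * ∑ t ∈ E₁.powerset, φ (Ω t) := by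
    intro φ
    have h : ∑ t ∈ E₁.powerset, φ (Ω t) = (2 : ℝ) ^ E₁.card * ∑ ω : Set (Sym2 V), weight w ω * φ ω :=
      sum_subcube_eq_weight ends B₀ E₁ hdis φ
    have h2 : c * (2 : ℝ) ^ E₁.card = 1 := by rw [hc, ← mul_pow]; norm_num
    calc ∑ ω : Set (Sym2 V), weight w ω * φ ω
        = (c * (2 : ℝ) ^ E₁.card) * ∑ ω : Set (Sym2 V), weight w ω * φ ω := by rw [h2, one_mul]
      _ = c * ∑ t ∈ E₁.powerset, φ (Ω t) := by rw [mul_assoc, ← h]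
  have hm : ∑ ω : Set (Sym2 V), weight w ω = 1 := by
    have h1 := bridge fun _ => (1 : ℝ)
    simp only [mul_one, Finset.sum_const, Finset.card_powerset, nsmul_eq_mul] at h1
    rw [h1, hc]
    push_cast
    rw [← mul_pow]; norm_num
  -- `U = univ`: restricted cluster / disconnection are the plain ones
  have hE : ∀ ω : Set (Sym2 V), ω ∩ edgesIn (Finset.univ : Finset V) = ω := fun ω => by
    ext e
    simp only [Set.mem_inter_iff, edgesIn, Set.mem_setOf_eq, Finset.mem_univ, imp_true_iff, and_true]
  have hC : ∀ ω, rC Finset.univ x ω = openEdgeCluster ω x := fun ω => by simp only [rC, hE]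
  have hDD : ∀ ω, ω ∈ rD Finset.univ x ({z} : Set V) ↔ z ∉ openCluster ω x := fun ω => by
    simp only [rD, hE, Set.mem_setOf_eq, Set.mem_singleton_iff, forall_eq, openCluster]
  -- the shifted functions of the edge cluster
  set vx : Set (Sym2 V) → Set V := fun C => {v | v = x ∨ ∃ e ∈ C, v ∈ e} with hvx
  have hvx_mono : Monotone vx := fun C C' hCC' v hv => by
    rcases hv with hv | ⟨e, he, hve⟩
    · exact Or.inl hv
    · exact Or.inr ⟨e, hCC' he, hve⟩
  have hx_vx : ∀ C, ({x} : Set V) ⊆ vx C := fun C v hv => Or.inl hv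
  have hvx_cl : ∀ ω : Set (Sym2 V), vx (openEdgeCluster ω x) = openCluster ω x := fun ω =>
    (openCluster_eq_verts_edgeCluster ω x).symm
  set F' : Set (Sym2 V) → ℝ := fun C => f (vx C) - f {x} with hF'
  set G' : Set (Sym2 V) → ℝ := fun C => g (vx C) - g {x} with hG'
  have hF'm : Monotone F' := fun C C' h => sub_le_sub_right (hf (hvx_mono h)) _
  have hG'm : Monotone G' := fun C C' h => sub_le_sub_right (hg (hvx_mono h)) _
  have hF'0 : ∀ C, 0 ≤ F' C := fun C => sub_nonneg.2 (hf (hx_vx C))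
  have hG'0 : ∀ C, 0 ≤ G' C := fun C => sub_nonneg.2 (hg (hx_vx C))
  -- BHK Theorem 1.1 / 1.3 in finite-sum form, `U = univ`, `X = Y = {z}`
  have hzU : ({z} : Set V) ⊆ ↑(Finset.univ : Finset V) := by simp
  have key := core w hw0 hw1 hm Finset.univ x (Finset.mem_univ x) {z} {z} hzU hzU F' G' hF'm hG'm hF'0 hG'0
  rw [Set.inter_self, Set.union_self] at key
  simp only [hC] at key
  -- evaluate the four weighted sums on the sub-cube
  set D' : Set (Set (Sym2 V)) := rD Finset.univ x ({z} : Set V) with hD'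
  have hind : ∀ t, ind D' (Ω t) = if z ∉ L t then 1 else 0 := fun t => by
    by_cases h : z ∉ L t
    · rw [if_pos h, ind_of_mem ((hDD (Ω t)).2 (by rw [hΩL]; exact h))]
    · rw [if_neg h, ind_of_not_mem (fun hm' => h (by rw [← hΩL]; exact (hDD (Ω t)).1 hm'))]
  have hF'Ω : ∀ t, F' (openEdgeCluster (Ω t) x) = f (L t) - f {x} := fun t => by
    simp only [hF', hvx_cl, hΩL]
  have hG'Ω : ∀ t, G' (openEdgeCluster (Ω t) x) = g (L t) - g {x} := fun t => by
    simp only [hG', hvx_cl, hΩL]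
  have ev : ∀ h : Finset ι → ℝ,
      ∑ t ∈ E₁.powerset, h t * (if z ∉ L t then (1 : ℝ) else 0) = ∑ t ∈ D, h t := fun h => by
    rw [hD, Finset.sum_filter]
    exact Finset.sum_congr rfl fun t _ => by split_ifs <;> simp
  have s1 : ∑ ω : Set (Sym2 V), weight w ω * (F' (openEdgeCluster ω x) * ind D' ω) = c * ∑ t ∈ D, (f (L t) - f {x}) := by
    rw [bridge, ← ev (fun t => f (L t) - f {x})]
    congr 1
    exact Finset.sum_congr rfl fun t _ => by rw [hF'Ω, hind]
  have s2 : ∑ ω : Set (Sym2 V), weight w ω * (G' (openEdgeCluster ω x) * ind D' ω) = c * ∑ t ∈ D, (g (L t) - g {x}) := by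
    rw [bridge, ← ev (fun t => g (L t) - g {x})]
    congr 1
    exact Finset.sum_congr rfl fun t _ => by rw [hG'Ω, hind]
  have s3 : ∑ ω : Set (Sym2 V), weight w ω * (F' (openEdgeCluster ω x) * G' (openEdgeCluster ω x) * ind D' ω)
      = c * ∑ t ∈ D, (f (L t) - f {x}) * (g (L t) - g {x}) := by
    rw [bridge, ← ev (fun t => (f (L t) - f {x}) * (g (L t) - g {x}))]
    congr 1
    exact Finset.sum_congr rfl fun t _ => by rw [hF'Ω, hG'Ω, hind]
  have s4 : ∑ ω : Set (Sym2 V), weight w ω * ind D' ω = c * (D.card : ℝ) := by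
    rw [bridge]
    congr 1
    have : ∑ t ∈ E₁.powerset, ind D' (Ω t) = ∑ t ∈ E₁.powerset, (1 : ℝ) * (if z ∉ L t then (1 : ℝ) else 0) :=
      Finset.sum_congr rfl fun t _ => by rw [hind, one_mul]
    rw [this, ev (fun _ => (1 : ℝ)), Finset.sum_const, nsmul_eq_mul, mul_one]
  rw [s1, s2, s3, s4] at key
  -- remove the common factor `c² > 0` and un-shift
  set N : ℝ := (D.card : ℝ) with hN
  set Sf := ∑ t ∈ D, f (L t) with hSf
  set Sg := ∑ t ∈ D, g (L t) with hSg
  set Sfg := ∑ t ∈ D, f (L t) * g (L t) with hSfg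
  have e1 : ∑ t ∈ D, (f (L t) - f {x}) = Sf - N * f {x} := by
    rw [Finset.sum_sub_distrib, Finset.sum_const, nsmul_eq_mul]
  have e2 : ∑ t ∈ D, (g (L t) - g {x}) = Sg - N * g {x} := by
    rw [Finset.sum_sub_distrib, Finset.sum_const, nsmul_eq_mul]
  have e3 : ∑ t ∈ D, (f (L t) - f {x}) * (g (L t) - g {x}) = Sfg - f {x} * Sg - g {x} * Sf + N * (f {x} * g {x}) := by
    have : ∀ t, (f (L t) - f {x}) * (g (L t) - g {x})
        = f (L t) * g (L t) - f {x} * g (L t) - g {x} * f (L t) + f {x} * g {x} := fun t => by ring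
    simp only [this, Finset.sum_add_distrib, Finset.sum_sub_distrib, ← Finset.mul_sum, Finset.sum_const, nsmul_eq_mul]
    rw [hSfg, hSf, hSg, hN]; ring
  rw [e1, e2, e3] at key
  have key' : (Sf - N * f {x}) * (Sg - N * g {x}) ≤ (Sfg - f {x} * Sg - g {x} * Sf + N * (f {x} * g {x})) * N := by
    have hcc : 0 < c * c := mul_pos hcpos hcpos
    have : c * c * ((Sf - N * f {x}) * (Sg - N * g {x}))
        ≤ c * c * ((Sfg - f {x} * Sg - g {x} * Sf + N * (f {x} * g {x})) * N) := by nlinarith [key]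
    exact le_of_mul_le_mul_left this hcc
  have iden : (Sf - N * f {x}) * (Sg - N * g {x}) - (Sfg - f {x} * Sg - g {x} * Sf + N * (f {x} * g {x})) * N
      = Sf * Sg - N * Sfg := by ring
  linarith [key', iden]

/-- **The covariance form of CELL-PA (multigraphs) used by the MEANS-K split** (memo CW-VDBHK-gen29 §8.3): in the notation of
`cell_conditionalPA_multi`,
for all constants `a, b` (in the application `a = f(K)`, `b = g(K)` with `K` the red cluster of the cell),
  `(Σ_{t∈D} (a − f(L t)))·(Σ_{t∈D} (b − g(L t))) ≤ |D| · Σ_{t∈D} (a − f(L t))·(b − g(L t))`,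
i.e. the cell's contribution to the first-rung sum `T = Σ_S Δf·Δg` is at least `|D|·Y_f·Y_g` (`Y_f = a −` cell average of `f(L)`).
[cite: VandenbergHaggstromKahn2005, Thm. 1.3 (p. 6)] -/
theorem cell_cov_form_multi (ends : ι → Sym2 V) (x z : V) (B₀ E₁ : Finset ι)
    (hdis : Disjoint B₀ E₁) (f g : Set V → ℝ) (hf : Monotone f) (hg : Monotone g) (a b : ℝ) :
    (∑ t ∈ E₁.powerset.filter (fun t => z ∉ openCluster (ends '' (↑(B₀ ∪ t) : Set ι)) x),
        (a - f (openCluster (ends '' (↑(B₀ ∪ t) : Set ι)) x))) *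
      (∑ t ∈ E₁.powerset.filter (fun t => z ∉ openCluster (ends '' (↑(B₀ ∪ t) : Set ι)) x),
        (b - g (openCluster (ends '' (↑(B₀ ∪ t) : Set ι)) x))) ≤
    ((E₁.powerset.filter (fun t => z ∉ openCluster (ends '' (↑(B₀ ∪ t) : Set ι)) x)).card : ℝ) *
      ∑ t ∈ E₁.powerset.filter (fun t => z ∉ openCluster (ends '' (↑(B₀ ∪ t) : Set ι)) x),
        (a - f (openCluster (ends '' (↑(B₀ ∪ t) : Set ι)) x)) * (b - g (openCluster (ends '' (↑(B₀ ∪ t) : Set ι)) x)) := by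
  have key := cell_conditionalPA_multi ends x z B₀ E₁ hdis f g hf hg
  set L : Finset ι → Set V := fun t => openCluster (ends '' (↑(B₀ ∪ t) : Set ι)) x with hL
  set D : Finset (Finset ι) := E₁.powerset.filter (fun t => z ∉ L t) with hD
  change (∑ t ∈ D, f (L t)) * (∑ t ∈ D, g (L t)) ≤ (D.card : ℝ) * ∑ t ∈ D, f (L t) * g (L t) at key
  change (∑ t ∈ D, (a - f (L t))) * (∑ t ∈ D, (b - g (L t))) ≤ (D.card : ℝ) * ∑ t ∈ D, (a - f (L t)) * (b - g (L t))
  set N : ℝ := (D.card : ℝ) with hN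
  set Sf := ∑ t ∈ D, f (L t) with hSf
  set Sg := ∑ t ∈ D, g (L t) with hSg
  set Sfg := ∑ t ∈ D, f (L t) * g (L t) with hSfg
  have e1 : ∑ t ∈ D, (a - f (L t)) = N * a - Sf := by
    rw [Finset.sum_sub_distrib, Finset.sum_const, nsmul_eq_mul]
  have e2 : ∑ t ∈ D, (b - g (L t)) = N * b - Sg := by
    rw [Finset.sum_sub_distrib, Finset.sum_const, nsmul_eq_mul]
  have e3 : ∑ t ∈ D, (a - f (L t)) * (b - g (L t)) = N * (a * b) - a * Sg - b * Sf + Sfg := by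
    have : ∀ t, (a - f (L t)) * (b - g (L t)) = a * b - a * g (L t) - b * f (L t) + f (L t) * g (L t) := fun t => by ring
    simp only [this, Finset.sum_add_distrib, Finset.sum_sub_distrib, ← Finset.mul_sum, Finset.sum_const, nsmul_eq_mul]
    rw [hSfg, hSf, hSg, hN]; ring
  rw [e1, e2, e3]
  have iden : (N * a - Sf) * (N * b - Sg) - N * (N * (a * b) - a * Sg - b * Sf + Sfg) = Sf * Sg - N * Sfg := by ring
  linarith [key, iden]


end Coefficientwise

end Summit.CriticalPhenomena.PercolationContinuityZ3.Theorems
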